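import Summits.CriticalPhenomena.PercolationContinuityZ3.Theorems.PercNearOneGluingAdditiveGluingFingerTwoContacts
import Summits.CriticalPhenomena.PercolationContinuityZ3.Theorems.PercNearOneGluingNearOneGluingKnLemma3i
import Summits.CriticalPhenomena.PercolationContinuityZ3.Theorems.PercNearOneGluingNearOneGluingPivotalityDomination
import HarnessLib

/-! # Crux `PercNearOneGluing.AdditiveGluing` (stmt-CriticalPhenomena-4576) — set-up lemmas for the two-contact-with-`b` FML3 certificate
# (seat (b) V⁺-form, depth prover `png-dp-vplus`)

Support file (`--supports stmt-CriticalPhenomena-4576`); no definitions, no named facts.  Tools for `…AdditiveGluingFingerTwoContactsB.lean`: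
* `tcb_contacts`: membership facts for the contact-pair set `F = {v w₁} ∪ {v w₂} ∪ {v b}` of a finger block and vanishing of the other
  weights at the block;
* `tcb_patterns`: the set `S` of non-empty patterns of a finite pair set `F` and the pattern expansion
  `μ_p(A ∩ R) = Σ_{T ∈ S} μ_p(cyl T) · μ_{pinW p F T}(A)` of the some-pair-of-`F`-open event `R` (`prodBernoulli_real_inter_eq_sum_pinW`);
* `tcb_row`: the base row — Kozma–Nitzan's Lemma 3(i) (`knLemma3i`) in the weighting with every pair at the block killed, for a weak pair
  `x < d`, localised to the increasing event `{d ↔ y}` (`pivDom_openConn_mono_openEdgeCluster`), read on the pairs avoiding the block;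
* `tcb_leaves`: the scalar bookkeeping of the certificate — from the class-mass facts (Harris, cross comparisons, swap) the multipliers
  `λ₁ = g₁/(c₀+u₀+u₂)`, `λ₂ = S − λ₁`, `y₂ = λ₂(c₀+u₀+u₁) − g₂` are non-negative and satisfy the fourteen leaf inequalities of
  `tcb_twoContactsB_pointwise` (case `u₂ ≤ u₁`; the other case is the mirror image).
[cite: KozmaNitzan2024, Lemma 3 (pp. 6–7), §3.1, §4 p. 20; Grimmett1999, Thm. (2.4) p. 34]
-/

namespace Summit.CriticalPhenomena.PercolationContinuityZ3.Theorems

open MeasureTheory Set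
open Literature.Probability.LatticeModels (prodBernoulli)
open Literature.Probability.Percolation (BondConfig openConn openGraph pinW localCylinder DeterminedBy determinedBy_iff)

noncomputable section
open Classical

section TwoContactsBSetup

open Literature.Probability.LatticeModels Literature.Probability.Percolation

variable {n : ℕ}

/-- **Contact pairs of a finger block touching `w₁, w₂, b`**: membership facts and vanishing of the remaining weights at the block.
[cite: KozmaNitzan2024, §3.1] -/
theorem tcb_contacts (K : Sym2 (Fin n) → unitInterval) (N : Finset (Fin n)) (F : Finset (Sym2 (Fin n))) (w₁ w₂ b : Fin n)
    (hw₁ : w₁ ∉ N) (hw₂ : w₂ ∉ N) (hbN : b ∉ N)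
    (hint : ∀ v ∈ N, ∀ v' ∈ N, v ≠ v' → K s(v, v') = 0)
    (hcont : ∀ v ∈ N, ∀ z : Fin n, z ∉ N → z ≠ w₁ → z ≠ w₂ → z ≠ b → K s(v, z) = 0)
    (hFdef : F = N.image (fun v => s(v, w₁)) ∪ N.image (fun v => s(v, w₂)) ∪ N.image (fun v => s(v, b))) :
    (∀ e ∈ F, ∃ v ∈ N, e = s(v, w₁) ∨ e = s(v, w₂) ∨ e = s(v, b)) ∧
    (∀ e ∈ F, ∃ v ∈ N, ∃ w ∉ N, e = s(v, w)) ∧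
    (∀ v ∈ N, s(v, w₁) ∈ F ∧ s(v, w₂) ∈ F ∧ s(v, b) ∈ F) ∧
    (∀ e : Sym2 (Fin n), e ∉ F → ¬ e.IsDiag → (∃ z ∈ e, z ∈ N) → K e = 0) ∧
    (∀ e : Sym2 (Fin n), e ∉ F → ¬ e.IsDiag → (∃ z ∈ e, z ∈ N) → ¬ (∀ z ∈ e, z ∈ N) → K e = 0) := by
  subst hFdef
  set F : Finset (Sym2 (Fin n)) := N.image (fun v => s(v, w₁)) ∪ N.image (fun v => s(v, w₂)) ∪ N.image (fun v => s(v, b))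
    with hFdef
  -- membership in `F`
  have hFmem : ∀ e ∈ F, ∃ v ∈ N, e = s(v, w₁) ∨ e = s(v, w₂) ∨ e = s(v, b) := by
    intro e he
    rcases Finset.mem_union.1 he with he' | h
    · rcases Finset.mem_union.1 he' with h | h
      · obtain ⟨v, hv, rfl⟩ := Finset.mem_image.1 h
        exact ⟨v, hv, Or.inl rfl⟩
      · obtain ⟨v, hv, rfl⟩ := Finset.mem_image.1 h
        exact ⟨v, hv, Or.inr (Or.inl rfl)⟩
    · obtain ⟨v, hv, rfl⟩ := Finset.mem_image.1 h
      exact ⟨v, hv, Or.inr (Or.inr rfl)⟩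
  have hF : ∀ e ∈ F, ∃ v ∈ N, ∃ w ∉ N, e = s(v, w) := by
    intro e he
    obtain ⟨v, hv, h⟩ := hFmem e he
    rcases h with rfl | rfl | rfl
    · exact ⟨v, hv, w₁, hw₁, rfl⟩
    · exact ⟨v, hv, w₂, hw₂, rfl⟩
    · exact ⟨v, hv, b, hbN, rfl⟩
  have hmemF : ∀ v ∈ N, s(v, w₁) ∈ F ∧ s(v, w₂) ∈ F ∧ s(v, b) ∈ F := by
    intro v hv
    refine ⟨?_, ?_, ?_⟩
    · exact Finset.mem_union.2 (Or.inl (Finset.mem_union.2 (Or.inl (Finset.mem_image.2 ⟨v, hv, rfl⟩))))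
    · exact Finset.mem_union.2 (Or.inl (Finset.mem_union.2 (Or.inr (Finset.mem_image.2 ⟨v, hv, rfl⟩))))
    · exact Finset.mem_union.2 (Or.inr (Finset.mem_image.2 ⟨v, hv, rfl⟩))
  -- weights at the block outside `F` vanish
  have hK0 : ∀ e : Sym2 (Fin n), e ∉ F → ¬ e.IsDiag → (∃ z ∈ e, z ∈ N) → K e = 0 := by
    intro e heF hdiag ⟨z, hz, hzN⟩
    have hother := Sym2.other_spec hz
    set z' := Sym2.Mem.other hz with hz'
    have hzz' : z ≠ z' := by
      intro h
      apply hdiag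
      rw [← hother, ← h]
      exact Sym2.mk_isDiag_iff.2 rfl
    rw [← hother]
    by_cases hz'N : z' ∈ N
    · exact hint z hzN z' hz'N hzz'
    · have h1 : z' ≠ w₁ := by
        intro h
        exact heF (hother ▸ h ▸ (hmemF z hzN).1)
      have h2 : z' ≠ w₂ := by
        intro h
        exact heF (hother ▸ h ▸ (hmemF z hzN).2.1)
      have h3 : z' ≠ b := by
        intro h
        exact heF (hother ▸ h ▸ (hmemF z hzN).2.2)
      exact hcont z hzN z' hz'N h1 h2 h3
  have hK0' : ∀ e : Sym2 (Fin n), e ∉ F → ¬ e.IsDiag → (∃ z ∈ e, z ∈ N) → ¬ (∀ z ∈ e, z ∈ N) → K e = 0 :=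
    fun e heF hdiag hz _ => hK0 e heF hdiag hz
  exact ⟨hFmem, hF, hmemF, hK0, hK0'⟩

/-- **Non-empty patterns of a finite pair set and the pattern expansion** of the some-pair-open event.
[cite: KozmaNitzan2024, §4 p. 20] -/
theorem tcb_patterns (F : Finset (Sym2 (Fin n))) :
    ∃ S : Finset (Finset (Sym2 (Fin n))), (∀ T ∈ S, T ⊆ F ∧ ∃ e ∈ F, e ∈ T) ∧
      (∀ T, T ⊆ F → (∃ e ∈ F, e ∈ T) → T ∈ S) ∧
      ∀ (p : Sym2 (Fin n) → unitInterval) (A : Set (BondConfig (Fin n))),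
        (prodBernoulli p).real (A ∩ {ω : Set (Sym2 (Fin n)) | ∃ e ∈ F, e ∈ ω}) =
        ∑ T ∈ S, (prodBernoulli p).real (localCylinder (↑F : Set (Sym2 (Fin n))) ↑T) *
          (prodBernoulli (pinW p (↑F : Set (Sym2 (Fin n))) ↑T)).real A := by
  have hmeas : ∀ s : Set (BondConfig (Fin n)), MeasurableSet s := fun _ => MeasurableSet.of_discrete
  set R : Set (BondConfig (Fin n)) := {ω : Set (Sym2 (Fin n)) | ∃ e ∈ F, e ∈ ω} with hR
  have hdetR : DeterminedBy R (↑F : Set (Sym2 (Fin n))) := DepthOneGluing.determinedBy_exists_mem F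
  refine ⟨@Finset.filter _ (fun T : Finset (Sym2 (Fin n)) => (↑T : Set (Sym2 (Fin n))) ∈ R) (_) F.powerset, ?_, ?_,
    fun p A => prodBernoulli_real_inter_eq_sum_pinW p F (hmeas A) hdetR⟩
  · intro T hT
    obtain ⟨hTF, hTR⟩ := (@Finset.mem_filter _ _ (_) _ _).1 hT
    refine ⟨Finset.mem_powerset.1 hTF, ?_⟩
    simpa [hR] using hTR
  · intro T hTF hex
    refine (@Finset.mem_filter _ _ (_) _ _).2 ⟨Finset.mem_powerset.2 hTF, ?_⟩
    simpa [hR] using hex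

/-- **The base row**: Kozma–Nitzan's Lemma 3(i) in the weighting with every pair at the block `N` killed, for the weak pair `x < d`,
localised to the increasing event `{d ↔ y}`, read on the pairs avoiding the block.  [cite: KozmaNitzan2024, Lemma 3(i) (pp. 6–7)] -/
theorem tcb_row (K : Sym2 (Fin n) → unitInterval) (N : Finset (Fin n)) (x y d b : Fin n)
    (hweak : (prodBernoulli (fun e : Sym2 (Fin n) => if (∃ z ∈ e, z ∈ N) then (0 : unitInterval) else K e)).real (openConn x b) ≤
      (prodBernoulli (fun e : Sym2 (Fin n) => if (∃ z ∈ e, z ∈ N) then (0 : unitInterval) else K e)).real (openConn d b)) :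
    (prodBernoulli (fun e : Sym2 (Fin n) => if (∃ z ∈ e, z ∈ N) then (0 : unitInterval) else K e)).real
        {ω : BondConfig (Fin n) | (openGraph ({e | e ∈ ω ∧ ∀ z ∈ e, z ∉ N} : Set (Sym2 (Fin n)))).Reachable x b ∧
          (openGraph ({e | e ∈ ω ∧ ∀ z ∈ e, z ∉ N} : Set (Sym2 (Fin n)))).Reachable d y} ≤
      (prodBernoulli (fun e : Sym2 (Fin n) => if (∃ z ∈ e, z ∈ N) then (0 : unitInterval) else K e)).real
        {ω : BondConfig (Fin n) | (openGraph ({e | e ∈ ω ∧ ∀ z ∈ e, z ∉ N} : Set (Sym2 (Fin n)))).Reachable d b ∧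
          (openGraph ({e | e ∈ ω ∧ ∀ z ∈ e, z ∉ N} : Set (Sym2 (Fin n)))).Reachable d y} := by
  set q : Sym2 (Fin n) → unitInterval := fun e => if (∃ z ∈ e, z ∈ N) then (0 : unitInterval) else K e with hq
  have hrow0 := knLemma3i n q x d b (openConn d y) 0 (pivDom_openConn_mono_openEdgeCluster d y) le_rfl (by linarith)
  have hq0 : ∀ e : Sym2 (Fin n), (∃ z ∈ e, z ∈ N) → q e = 0 := fun e he => by simp only [hq, he, if_true]
  have hqae : ∀ᵐ ω ∂(prodBernoulli q), ∀ e : Sym2 (Fin n), (∃ z ∈ e, z ∈ N) → e ∉ ω := by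
    rw [Filter.eventually_all]
    intro e
    by_cases he : ∃ z ∈ e, z ∈ N
    · filter_upwards [prodBernoulli_ae_notMem q (hq0 e he)] with ω hω
      exact fun _ => hω
    · exact Filter.Eventually.of_forall fun ω h => (he h).elim
  have hconv : ∀ P : SimpleGraph (Fin n) → Prop, (prodBernoulli q).real {ω : BondConfig (Fin n) | P (openGraph ω)} =
      (prodBernoulli q).real {ω : BondConfig (Fin n) | P (openGraph ({e | e ∈ ω ∧ ∀ z ∈ e, z ∉ N} : Set (Sym2 (Fin n))))} := by
    intro P
    refine measureReal_congr ?_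
    filter_upwards [hqae] with ω hω
    have hωN : ({e | e ∈ ω ∧ ∀ z ∈ e, z ∉ N} : Set (Sym2 (Fin n))) = ω := by
      ext e
      constructor
      · exact fun h => h.1
      · intro heω
        refine ⟨heω, fun z hz hzN => hω e ⟨z, hz, hzN⟩ heω⟩
    show (ω ∈ {ω : BondConfig (Fin n) | P (openGraph ω)}) = (ω ∈ {ω : BondConfig (Fin n) | P (openGraph ({e | e ∈ ω ∧ ∀ z ∈ e, z ∉ N} : Set (Sym2 (Fin n))))})
    simp only [Set.mem_setOf_eq]
    rw [hωN]
  have e1 := hconv (fun G => G.Reachable x b ∧ G.Reachable d y)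
  have e2 := hconv (fun G => G.Reachable d b ∧ G.Reachable d y)
  rw [← e1, ← e2]
  have h1 : (openConn x b ∩ openConn d y : Set (BondConfig (Fin n))) = {ω | (openGraph ω).Reachable x b ∧ (openGraph ω).Reachable d y} := rfl
  have h2 : (openConn d b ∩ openConn d y : Set (BondConfig (Fin n))) = {ω | (openGraph ω).Reachable d b ∧ (openGraph ω).Reachable d y} := rfl
  rw [← h1, ← h2]
  linarith [hrow0]

/-- **Scalar bookkeeping of the certificate** (case `u₂ ≤ u₁`): non-negative multipliers `λ₁, λ₂, y₂` satisfying the fourteen leaf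
inequalities of `tcb_twoContactsB_pointwise`, from the class-mass facts.  [cite: KozmaNitzan2024, §4 p. 20] -/
theorem tcb_leaves (c0 u0 u12 u1 u2 uc g12b g1b g2b gb g12 g1 g2 Stot : ℝ)
    (hc0_nonneg : 0 ≤ c0) (hu00 : 0 ≤ u0) (hu10 : 0 ≤ u1) (hu20 : 0 ≤ u2) (huc0 : 0 ≤ uc)
    (hg1b0 : 0 ≤ g1b) (hg2b0 : 0 ≤ g2b) (hgb0 : 0 ≤ gb) (hg10 : 0 ≤ g1) (hg20 : 0 ≤ g2)
    (hStot0 : 0 ≤ Stot) (hmass : Stot + c0 = 1) (hSU : Stot = uc + u12 + u1 + u2 + u0)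
    (hSG : Stot = g12b + g1b + g2b + gb + g12 + g1 + g2) (hcross1 : u1 + u2 + uc ≤ g12b + g1b + g2b + gb) (hcross2 : g1 + g2 ≤ u0)
    (hHar : u0 ≤ Stot * (u0 + c0)) (hswap1 : g1 * u1 ≤ u0 * (gb + g1b)) (hcase : u2 ≤ u1) :
    ∃ l1 l2 y2 : ℝ, 0 ≤ l1 ∧ 0 ≤ l2 ∧ 0 ≤ y2 ∧ l1 + l2 = Stot ∧ y2 = l2 * (c0 + u0 + u1) - g2 ∧
      c0 * l1 + l1 * u0 + l1 * u2 = g1 ∧ l1 * u1 ≤ gb + g1b ∧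
      0 ≤ c0 * l2 - g2 + l2 * u0 + l2 * u1 - y2 ∧
      0 ≤ c0 * l1 - g1 + l1 * u0 + l1 * u2 ∧
      0 ≤ c0 * l1 + c0 * l2 - g1 - g12 - g2 + l1 * u0 + l1 * u12 + l2 * u0 + l2 * u12 ∧
      0 ≤ c0 * l1 + c0 * l2 - g1 - g12 - g2 + l1 * u0 + l1 * u12 + l1 * u2 + l2 * u0 + l2 * u1 + l2 * u12 ∧
      0 ≤ -c0 * l1 - c0 * l2 + g1 + g12 + g12b + g1b + g2 + g2b + gb - l1 * u0 - l1 * u1 - l1 * u12 - l1 * u2 - l1 * uc -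
        l2 * u0 - l2 * u1 - l2 * u12 - l2 * u2 - l2 * uc ∧
      0 ≤ -c0 * l1 + g1 + g1b + gb - l1 * u0 - l1 * u1 ∧
      0 ≤ -c0 * l1 + g1 + g12 + g12b + g1b + g2b + gb - l1 * u0 - l1 * u1 - l1 * u12 - l1 * u2 - l1 * uc - l2 * u12 -
        l2 * u2 - l2 * uc ∧
      0 ≤ -c0 * l2 + g2 + g2b + gb - l2 * u0 - l2 * u2 + y2 ∧
      0 ≤ gb ∧
      0 ≤ g2b + gb + l2 * u1 - l2 * u2 ∧
      0 ≤ -c0 * l2 + g12 + g12b + g1b + g2 + g2b + gb - l1 * u1 - l1 * u12 - l1 * uc - l2 * u0 - l2 * u1 - l2 * u12 -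
        l2 * u2 - l2 * uc ∧
      0 ≤ g1b + gb - l1 * u1 + l1 * u2 ∧
      0 ≤ g12b + g1b + g2b + gb - l1 * u1 - l1 * u2 - l1 * uc - l2 * u1 - l2 * u2 - l2 * uc ∧
      0 ≤ g12b + g1b + g2b + gb - l1 * u1 - l1 * uc - l2 * u2 - l2 * uc := by
  have hc0e : c0 = 1 - Stot := by linarith [hmass]
  have hSt1 : Stot ≤ 1 := by linarith [hmass]
  have hMb : u1 + u2 + uc ≤ g12b + g1b + g2b + gb := hcross1
  have hP1 : Stot * (u1 + u2 + uc) ≤ u1 + u2 + uc := mul_le_of_le_one_left (by linarith) hSt1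
  set D1 : ℝ := c0 + u0 + u2 with hD1
  have hD10 : 0 ≤ D1 := by rw [hD1]; linarith
  have hgbs : 0 ≤ gb + g1b := by linarith
  have hswap1w : g1 * u1 ≤ D1 * (gb + g1b) := by
    rw [hD1]; nlinarith [hswap1, mul_nonneg hc0_nonneg hgbs, mul_nonneg hu20 hgbs]
  set l1 : ℝ := g1 / D1 with hl1def
  have hl1 : 0 ≤ l1 := div_nonneg hg10 hD10
  have hl1D : l1 * D1 = g1 := by
    by_cases hz : D1 = 0
    · have hg1z : g1 = 0 := by linarith [hcross2, hg20, hu00, hc0_nonneg, hu20, hg10, hD1, hz]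
      rw [hz, mul_zero, hg1z]
    · exact div_mul_cancel₀ g1 hz
  have hl1cu' : c0 * l1 + l1 * u0 + l1 * u2 = g1 := by rw [hD1] at hl1D; linear_combination hl1D
  have hSD : Stot * D1 = Stot * (u0 + c0) + Stot * u2 := by rw [hD1]; ring
  have hl1S : l1 ≤ Stot := by
    by_cases hz : D1 = 0
    · rw [hl1def, hz, div_zero]; exact hStot0
    · rw [hl1def, div_le_iff₀ (lt_of_le_of_ne hD10 (Ne.symm hz))]
      linarith [hcross2, hg20, hHar, hSD, mul_nonneg hStot0 hu20]
  set l2 : ℝ := Stot - l1 with hl2def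
  have hl2 : 0 ≤ l2 := by rw [hl2def]; linarith
  set y2 : ℝ := l2 * (c0 + u0 + u1) - g2 with hy2def
  have hy2 : 0 ≤ y2 := by
    have e : y2 = Stot * (u0 + c0) - (c0 * l1 + l1 * u0) + l2 * u1 - g2 := by rw [hy2def, hl2def]; ring
    rw [e]
    linarith [hHar, hcross2, hl1cu', mul_nonneg hl2 hu10, mul_nonneg hl1 hu20]
  have hsw : l1 * u1 ≤ gb + g1b := by
    by_cases hz : D1 = 0
    · have : l1 = 0 := by rw [hl1def, hz, div_zero]
      rw [this, zero_mul]; linarith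
    · have hpos : 0 < D1 := lt_of_le_of_ne hD10 (Ne.symm hz)
      refine le_of_mul_le_mul_right ?_ hpos
      calc l1 * u1 * D1 = g1 * u1 := by rw [mul_comm l1 u1, mul_assoc, hl1D, mul_comm]
        _ ≤ D1 * (gb + g1b) := hswap1w
        _ = (gb + g1b) * D1 := mul_comm _ _
  -- the fourteen leaf inequalities
  have hR1 : 0 ≤ c0 * l2 - g2 + l2 * u0 + l2 * u1 - y2 := by
    have e : c0 * l2 - g2 + l2 * u0 + l2 * u1 - y2 = 0 := by rw [hy2def]; ring
    rw [e]
  have hR2 : 0 ≤ c0 * l1 - g1 + l1 * u0 + l1 * u2 := by linarith [hl1cu']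
  have hR3 : 0 ≤ c0 * l1 + c0 * l2 - g1 - g12 - g2 + l1 * u0 + l1 * u12 + l2 * u0 + l2 * u12 := by
    have e : c0 * l1 + c0 * l2 - g1 - g12 - g2 + l1 * u0 + l1 * u12 + l2 * u0 + l2 * u12 =
        (g12b + g1b + g2b + gb) - Stot * (u1 + u2 + uc) := by
      rw [hl2def]; linear_combination (-Stot) * hSU + hSG + Stot * hmass
    rw [e]; linarith
  have hR4 : 0 ≤ c0 * l1 + c0 * l2 - g1 - g12 - g2 + l1 * u0 + l1 * u12 + l1 * u2 + l2 * u0 + l2 * u1 + l2 * u12 := by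
    linarith [hR3, mul_nonneg hl1 hu20, mul_nonneg hl2 hu10]
  have hR5 : 0 ≤ -c0 * l1 - c0 * l2 + g1 + g12 + g12b + g1b + g2 + g2b + gb - l1 * u0 - l1 * u1 - l1 * u12 - l1 * u2 - l1 * uc -
      l2 * u0 - l2 * u1 - l2 * u12 - l2 * u2 - l2 * uc := by
    have e : -c0 * l1 - c0 * l2 + g1 + g12 + g12b + g1b + g2 + g2b + gb - l1 * u0 - l1 * u1 - l1 * u12 - l1 * u2 - l1 * uc -
        l2 * u0 - l2 * u1 - l2 * u12 - l2 * u2 - l2 * uc = 0 := by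
      rw [hl2def]; linear_combination Stot * hSU - hSG - Stot * hmass
    rw [e]
  have hR6 : 0 ≤ -c0 * l1 + g1 + g1b + gb - l1 * u0 - l1 * u1 := by linarith [hl1cu', hsw, mul_nonneg hl1 hu20]
  have hR7 : 0 ≤ -c0 * l1 + g1 + g12 + g12b + g1b + g2b + gb - l1 * u0 - l1 * u1 - l1 * u12 - l1 * u2 - l1 * uc - l2 * u12 -
      l2 * u2 - l2 * uc := by
    have e : -c0 * l1 + g1 + g12 + g12b + g1b + g2b + gb - l1 * u0 - l1 * u1 - l1 * u12 - l1 * u2 - l1 * uc - l2 * u12 -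
        l2 * u2 - l2 * uc = y2 := by
      rw [hy2def, hl2def]; linear_combination Stot * hSU - hSG - Stot * hmass
    rw [e]; exact hy2
  have hR8 : 0 ≤ -c0 * l2 + g2 + g2b + gb - l2 * u0 - l2 * u2 + y2 := by
    have e : -c0 * l2 + g2 + g2b + gb - l2 * u0 - l2 * u2 + y2 = g2b + gb + l2 * (u1 - u2) := by rw [hy2def]; ring
    rw [e]; linarith [hg2b0, hgb0, mul_nonneg hl2 (sub_nonneg.2 hcase)]
  have hR9 : 0 ≤ gb := hgb0
  have hR10 : 0 ≤ g2b + gb + l2 * u1 - l2 * u2 := by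
    have e : g2b + gb + l2 * u1 - l2 * u2 = g2b + gb + l2 * (u1 - u2) := by ring
    rw [e]; linarith [hg2b0, hgb0, mul_nonneg hl2 (sub_nonneg.2 hcase)]
  have hR11 : 0 ≤ -c0 * l2 + g12 + g12b + g1b + g2 + g2b + gb - l1 * u1 - l1 * u12 - l1 * uc - l2 * u0 - l2 * u1 - l2 * u12 -
      l2 * u2 - l2 * uc := by
    have e : -c0 * l2 + g12 + g12b + g1b + g2 + g2b + gb - l1 * u1 - l1 * u12 - l1 * uc - l2 * u0 - l2 * u1 - l2 * u12 -
        l2 * u2 - l2 * uc = c0 * l1 + l1 * u0 + l1 * u2 - g1 := by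
      rw [hl2def]; linear_combination Stot * hSU - hSG - Stot * hmass
    rw [e]; linarith [hl1cu']
  have hR12 : 0 ≤ g1b + gb - l1 * u1 + l1 * u2 := by linarith [hsw, mul_nonneg hl1 hu20]
  have hR13 : 0 ≤ g12b + g1b + g2b + gb - l1 * u1 - l1 * u2 - l1 * uc - l2 * u1 - l2 * u2 - l2 * uc := by
    have e : g12b + g1b + g2b + gb - l1 * u1 - l1 * u2 - l1 * uc - l2 * u1 - l2 * u2 - l2 * uc =
        (g12b + g1b + g2b + gb) - Stot * (u1 + u2 + uc) := by rw [hl2def]; ring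
    rw [e]; linarith
  have hR14 : 0 ≤ g12b + g1b + g2b + gb - l1 * u1 - l1 * uc - l2 * u2 - l2 * uc := by
    linarith [hR13, mul_nonneg hl1 hu20, mul_nonneg hl2 hu10]
  exact ⟨l1, l2, y2, hl1, hl2, hy2, (by rw [hl2def]; ring), hy2def, hl1cu', hsw, hR1, hR2, hR3, hR4, hR5, hR6, hR7, hR8, hR9, hR10,
    hR11, hR12, hR13, hR14⟩

end TwoContactsBSetup

end

end Summit.CriticalPhenomena.PercolationContinuityZ3.Theorems
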